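import Literature.MathematicalPhysics.QuantumFieldTheory.QCDOS

/-!
# Asymptotic scaling forces the inverse bare coupling to diverge

Two elementary consequences of the two-loop asymptotic-freedom profile `afBeta N_f Λ a = 2 b₀ ℓ + 2 (b₁/b₀) log ℓ`,
`ℓ = log (1/(a² Λ²))` (Montvay–Münster §3.3.3 (3.263)–(3.265); Creutz (13.19)), recorded once for every lattice-QCD route that
runs along an asymptotically scaling scheme (`QCDScheme.HasAsymptoticScaling`: `β_k − afBeta N_f Λ a_k → 0`):

* `tendsto_afBeta_atTop` — for `N_f ≤ 16` (`b₀ > 0`) and `Λ > 0` the profile diverges, `afBeta N_f Λ a_k → +∞`, along every sequence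
  of lattice spacings `a_k → 0⁺` (the `log ℓ` term is `o(ℓ)` whatever the sign of `b₁`);
* `QCDScheme.tendsto_beta_atTop_of_hasAsymptoticScaling` — hence the inverse bare coupling of an asymptotically scaling scheme with
  `N_f ≤ 16` diverges, `β_k → +∞` (`g₀ → 0`), and in particular is eventually `≥ β₀` for every `β₀`
  (`QCDScheme.eventually_le_beta_of_hasAsymptoticScaling`).

Pure real analysis over the tree's definitions `afBeta`, `betaCoeff₀`, `QCDScheme`; no named facts.  Not here: rates
(`β_k = 2 b₀ log a_k⁻² + O(log log)`, see the routes' AF bookkeeping lemmas) and anything about `N_f ≥ 17`.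
-/

namespace Literature.MathematicalPhysics.QuantumFieldTheory

open Filter
open _root_.Topology

/-- **The two-loop asymptotic-freedom profile diverges**: for `N_f ≤ 16` (`b₀ > 0`), `Λ > 0` and lattice spacings
`a_k → 0⁺`, `afBeta N_f Λ a_k → +∞` — `afBeta = ℓ (2 b₀ + 2 (b₁/b₀) (log ℓ)/ℓ)` with `ℓ = log (1/(a²Λ²)) → ∞` and
`(log ℓ)/ℓ → 0`. [cite: MontvayMunster1994, §3.3.3 (3.263)–(3.265)] -/
theorem tendsto_afBeta_atTop {Nf : ℕ} (hNf : Nf ≤ 16) {Λ : ℝ} (hΛ : 0 < Λ) {a : ℕ → ℝ}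
    (ha : ∀ k, 0 < a k) (ha0 : Tendsto a atTop (𝓝 0)) :
    Tendsto (fun k => afBeta Nf Λ (a k)) atTop atTop := by
  have hb₀ : 0 < betaCoeff₀ Nf := by
    unfold betaCoeff₀
    have h : (Nf : ℝ) ≤ 16 := by exact_mod_cast hNf
    exact div_pos (by linarith) (by positivity)
  -- the large logarithm `ℓ_k = log (1/(a_k² Λ²)) → +∞`
  obtain ⟨ℓ, hℓ_def⟩ : ∃ ℓ : ℕ → ℝ, ∀ k, ℓ k = Real.log (1 / (a k ^ 2 * Λ ^ 2)) := ⟨_, fun _ => rfl⟩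
  have hℓ : Tendsto ℓ atTop atTop := by
    have h1 : Tendsto (fun k => a k ^ 2 * Λ ^ 2) atTop (𝓝[>] 0) := by
      refine tendsto_nhdsWithin_iff.mpr ⟨?_, Eventually.of_forall fun k => ?_⟩
      · simpa using (ha0.pow 2).mul_const (Λ ^ 2)
      · have := ha k
        show 0 < a k ^ 2 * Λ ^ 2
        positivity
    have h2 := Real.tendsto_log_atTop.comp h1.inv_tendsto_nhdsGT_zero
    refine h2.congr' (Eventually.of_forall fun k => ?_)
    simp [hℓ_def, one_div]
  have hℓpos : ∀ᶠ k in atTop, 0 < ℓ k := hℓ.eventually_gt_atTop 0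
  -- `afBeta = ℓ · (2 b₀ + 2 (b₁/b₀) (log ℓ / ℓ))`, second factor `→ 2 b₀ > 0`
  have hq : Tendsto (fun k => 2 * betaCoeff₀ Nf +
      2 * (betaCoeff₁ Nf / betaCoeff₀ Nf) * (Real.log (ℓ k) / ℓ k)) atTop (𝓝 (2 * betaCoeff₀ Nf)) := by
    have h1 : Tendsto (fun k => Real.log (ℓ k) / ℓ k) atTop (𝓝 0) :=
      Real.isLittleO_log_id_atTop.tendsto_div_nhds_zero.comp hℓ
    have h2 := (h1.const_mul (2 * (betaCoeff₁ Nf / betaCoeff₀ Nf))).const_add (2 * betaCoeff₀ Nf)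
    simpa using h2
  have hprod := hℓ.atTop_mul_pos (by positivity : (0 : ℝ) < 2 * betaCoeff₀ Nf) hq
  refine hprod.congr' ?_
  filter_upwards [hℓpos] with k hk
  rw [afBeta, ← hℓ_def k]
  field_simp

namespace QCDScheme

variable {Nf : ℕ}

/-- **Asymptotic scaling ⇒ `β_k → +∞`** (`N_f ≤ 16`): the inverse bare coupling `β = 2/g₀²` of an asymptotically scaling
scheme diverges along the sequence (`β_k = afBeta N_f Λ a_k + o(1)` and the profile diverges, `tendsto_afBeta_atTop`).
[cite: MontvayMunster1994, §3.3.3 (3.263)–(3.265)] -/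
theorem tendsto_beta_atTop_of_hasAsymptoticScaling (hNf : Nf ≤ 16) (sch : QCDScheme Nf)
    (h : sch.HasAsymptoticScaling) : Tendsto sch.β atTop atTop := by
  obtain ⟨Λ, hΛ, hε⟩ := h
  have hA := tendsto_afBeta_atTop hNf hΛ sch.a_pos sch.tendsto_a
  have hε' : ∀ᶠ k in atTop, (-1 : ℝ) ≤ sch.β k - afBeta Nf Λ (sch.a k) := by
    have h1 : ∀ᶠ k in atTop, sch.β k - afBeta Nf Λ (sch.a k) ∈ Set.Ioi (-1 : ℝ) :=
      hε (Ioi_mem_nhds (by norm_num))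
    filter_upwards [h1] with k hk
    exact le_of_lt hk
  have h2 := tendsto_atTop_add_right_of_le' atTop (-1 : ℝ) hA hε'
  refine h2.congr' (Eventually.of_forall fun k => ?_)
  show afBeta Nf Λ (sch.a k) + (sch.β k - afBeta Nf Λ (sch.a k)) = sch.β k
  ring

/-- Under asymptotic scaling with `N_f ≤ 16` the inverse bare coupling eventually exceeds any level: `∀ β₀, ∀ᶠ k, β₀ ≤ β_k`.
[cite: MontvayMunster1994, §3.3.3 (3.263)–(3.265)] -/
theorem eventually_le_beta_of_hasAsymptoticScaling (hNf : Nf ≤ 16) (sch : QCDScheme Nf)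
    (h : sch.HasAsymptoticScaling) (β₀ : ℝ) : ∀ᶠ k in atTop, β₀ ≤ sch.β k :=
  (tendsto_beta_atTop_of_hasAsymptoticScaling hNf sch h).eventually_ge_atTop β₀

end QCDScheme

/-- For a `QCDRegularisation` one of whose schemes scales asymptotically (`N_f ≤ 16`): `β_k → +∞` (the coupling sequence of
`reg.scheme m z shift` is `reg.β` by definition). [cite: MontvayMunster1994, §3.3.3 (3.263)–(3.265)] -/
theorem QCDRegularisation.tendsto_beta_atTop_of_hasAsymptoticScaling {Nf : ℕ} (hNf : Nf ≤ 16) (reg : QCDRegularisation Nf)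
    (m : Fin Nf → ℝ) (z shift : QCDField Nf → ℕ → ℝ) (h : (reg.scheme m z shift).HasAsymptoticScaling) :
    Tendsto reg.β atTop atTop :=
  QCDScheme.tendsto_beta_atTop_of_hasAsymptoticScaling hNf (reg.scheme m z shift) h

end Literature.MathematicalPhysics.QuantumFieldTheory
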